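import Summits.QuantumFields.YangMills.Theorems.AlphaInputsT3ACv3DataSchemaChi
import Summits.QuantumFields.YangMills.Theorems.AlphaInputsT3ACv3CoreNonemptyR
import Summits.QuantumFields.YangMills.Theorems.AlphaInputsT3ACRecordWitness
import HarnessLib

/-!
# `AlphaInputsT3ACMinimiserPinKnitRecChi` — THE KNIT AND THE RECORD-PARAMETRIC DISPLAY OF 2′χ OVER THE READ-LOCAL CLASS (R-57χ NAME-MAP port «MinimiserPin*
# knit ↦ …Chi», owner RULING g23-№2 ADDENDA 2∕5∕6, R57chi README «TO COME»): `DataSchemaT3ACRChi` ⇐ [7] Thm 1 + sizes + (D6R)∕(D6R-CHARGED) + the χ data rows;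
# ★ `AlphaInputsT3AC.PinnedPartsT3ACRecRChi L` = 2′χ displayed as ONE predicate; ★ its constants shell is a theorem — lane `pub-balaban3d`, seat alpha-1 (g12)

Cell `ym3-torus`, route `UnitScaleTilt`, crux 2′ → 2′χ (`AlphaInputsT3ACv3RecChi L`, stmt-QuantumFields-19936 ∕ -19935 ∕ -20520).  Lane A's `…MinimiserPinKnit(Rec)` and
alpha-2's `…v3DataSchemaR` §3 ∕ `…v3CoreNonemptyR` §§2–3 VERBATIM in χ-currency: the displayed step data carry print's lower row `fibre57LowOn` (`AlphaV3AC.StepDataV3ChiAC`,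
sibling `AlphaInputsT3ACv3DataSchemaChi`) in place of the retired R3D-02; the trivial-history pin (`trivMinimiserRowsT3_of_thm1GlobalMinAt`), the window inequality
(`MinimiserPin.windowIneqT3_of_le`), the closed-form `γ`-rows (`MinimiserPin.anti_of_C68` ∕ `small_of_C68` ∕ `C68_dom_of_le`) and the uncharged half of (D6R) under the collar
(`adaptedClassNonemptyT3R_of_charged_of_collar` ⇐ `collarE_T3_of_M₁_ge`, `four_pi_le_C68_of_sizes`) are REUSED by name; only the data row `hrows` changes currency
(`DataRowsT3R ↦ DataRowsT3RChi`).
* §1 `dataSchemaT3ACRChi_of_pinnedRows` ((O∀χ): χ data rows for EVERY pinned family; (D6R) displayed), `dataSchemaT3ACRChi_of_pinnedRows₂C` (sizes in closed form incl.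
  `7L + 3 ≤ M₁`, (D6R-CHARGED), the print-strength row (O″χ) «`(∃ Ut, Triv… Ut) → ∃ Ut, Triv… Ut ∧ DataRowsT3RChi … Ut`»).
* §2 ★ `AlphaInputsT3AC.PinnedPartsT3ACRecRChi L` (hypothesis schema, OPEN; NAME MAP `PinnedPartsT3ACRecR ↦ PinnedPartsT3ACRecRChi`) = the quantifier shell of 2′χ's text with
  body «exact p-profile · [7] constants in print's small-`a₁` regime · `1 ≤ 2B₃` · three `C68`-rows LINEAR in `C68` · `7L + 3 ≤ M₁` · (T) `Thm1GlobalMinAt L a₀ a₁ B₃` · per family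
  (D6R-CHARGED) and (O″χ)»; `dataSchemaT3ACRChi_of_pinnedPartsRChi_cast` (per family, transport along `hF`); ★ `pinnedPartsT3ACRecR_shell`: the CONSTANTS SHELL shared by
  `PinnedPartsT3ACRecR` and `PinnedPartsT3ACRecRChi` HOLDS for every `L > 1` (lane A's `pinnedPartsT3ACRec_shell` run on alpha-2's `exists_record_sizes_M₁`) — so ALL content
  of 2′χ's display is (T) + (D6R-CHARGED) + (O″χ).  The assembly `PinnedPartsT3ACRecRChi L → AlphaInputsT3ACv3RecChi L` is the sibling `AlphaInputsT3ACv3OfDataSchemaChi`.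
HONEST FRAMING.  Kernel theorems about the tree's own objects plus ONE hypothesis schema (`def … : Prop`, never asserted).  Nothing of the cluster expansion
([Balaban1985UV3] §§2–3), of [Balaban1985Variational] Thm 1 or of [Balaban1985Averaging] is proved; (T), (D6R-CHARGED), (O″χ) stay DISPLAYED; the data rows are displayed
FOR pinned∕constructed minimisers (lane B's honesty line, unchanged).  Count-neutral helper toward 2′χ; registry untouched; not a claim about d = 4, the continuum limit, or
the mass gap.
References: T. Bałaban, Commun. Math. Phys. 102 (1985) 255–275 [Balaban1985UV3], (7) p. 257, (40)–(42) p. 266, (47) p. 267, (68)–(71) p. 273, Thm 2 p. 272; Commun.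
Math. Phys. 102 (1985) 277–309 [Balaban1985Variational], Thm 1 (6)–(8) pp. 278–279; Commun. Math. Phys. 98 (1985) 17–51 [Balaban1985Averaging], Prop. 2 (54) p. 26.
-/

set_option autoImplicit false

noncomputable section

namespace Summit.QuantumFields.YangMills.Theorems

open MeasureTheory Set
open scoped Matrix Matrix.Norms.L2Operator
open Literature.MathematicalPhysics.QuantumFieldTheory.Balaban1983to89
open Literature.MathematicalPhysics.QuantumFieldTheory.Balaban1983to89.T3ContinuumYM3Torus
open Literature.MathematicalPhysics.QuantumFieldTheory.Balaban1983to89.T3UnitScaleTilt (θBal)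
open Literature.MathematicalPhysics.QuantumFieldTheory.Balaban1983to89.T3PrintedMinimiserExistence (Thm1GlobalMinAt)
open Literature.MathematicalPhysics.QuantumFieldTheory.Balaban1983to89.T3Thresholds (sqrt_le_exp_iff)
open Literature.MathematicalPhysics.QuantumFieldTheory.Balaban1983to89.ExpMeanLog (deltaSU deltaSU_pos)
open Literature.MathematicalPhysics.QuantumFieldTheory.Balaban1985CMP102
open Literature.MathematicalPhysics.QuantumFieldTheory.Balaban1985CMP102.Setting
open Summit.QuantumFields.Balaban3D.Carriers
open Summit.QuantumFields.Balaban3D.Proofs.Primitives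
open Summit.QuantumFields.Balaban3D.Proofs.GroupModelLieC (lieC)
open Summit.QuantumFields.Balaban3D.Proofs.TowerAC
open Summit.QuantumFields.Balaban3D.Proofs.StandardAC
open Summit.QuantumFields.Balaban3D.Proofs.InputsAC
open Summit.QuantumFields.Balaban3D.Proofs.AlphaAC (AlphaDataAC)
open Summit.QuantumFields.Balaban3D.Proofs.Thresholds (Q0 Q0_pos)
open Summit.QuantumFields.YangMills.Theorems.AlphaV3AC
open B7Prop2Explicit (C0 C0_pos)

/-! ## §1 The knit to the χ-schema: [7] Thm 1 + sizes + (D6R)∕(D6R-CHARGED) + the χ data rows -/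

section Knit

variable (F : T3Family) (𝔠 : AlphaConsts F.L (suGroupModel 2).N)

/-- **`DataSchemaT3ACRChi` FROM [7] THM 1 (displayed) + SIZE CONDITIONS + (D6R) + THE χ DATA ROWS FOR EVERY PINNED FAMILY** — alpha-2's `dataSchemaT3ACR_of_pinnedRows`
verbatim in χ-currency: the trivial-history pin (`trivMinimiserRowsT3_of_thm1GlobalMinAt`) and the window inequality (`MinimiserPin.windowIneqT3_of_le`) are lane A's theorems;
only `hrows` changes currency (`DataRowsT3R ↦ DataRowsT3RChi`). [cite: Balaban1985UV3, Thm 2 p.272 + (40)–(42) p.266 + (47) p.267 + (67)–(68) p.273; Balaban1985Variational, Thm 1 (8) p.279] -/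
theorem AlphaInputsT3AC.dataSchemaT3ACRChi_of_pinnedRows {a₀ a₁ : ℝ}
    (hT : Thm1GlobalMinAt F.L a₀ a₁ 𝔠.B₃) (hwin : 𝔠.B₃ * a₁ ≤ a₀)
    (hA3 : (143 * ((((3 + 4 : ℕ) : ℝ)) ^ 2 / 4) ^ 2) * (2 * (𝔠.B₃ * a₁)) ≤ 1 / 3)
    (hA2 : 2 * (2 * (𝔠.B₃ * a₁)) ≤ 2 * deltaSU (Fin 2) / (((3 + 4) * F.L : ℕ) : ℝ) ^ 2)
    (hB₃ : 1 ≤ 2 * 𝔠.B₃) (hC : 4 * 𝔠.B₃ * (F.L : ℝ) ^ 2 * avgWindowFactor F.L ≤ 𝔠.C68)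
    (hanti : (min 𝔠.gamma0 1) ^ 2 ≤ Real.exp (2 * (1 - 𝔠.p₀)))
    (hsmall : ∀ γ : ℝ, 0 < γ → γ ≤ (min 𝔠.gamma0 1) ^ 2 →
      ∀ K k : ℕ, 2 * (F.L : ℝ) ^ 2 * avgWindowFactor F.L * θBal F.L γ 𝔠.b₀ 𝔠.p₀ (K - k + 1) ≤ a₁)
    (hD6R : ∀ (γ : ℝ) (hγ : 0 < γ) (hγ1 : γ ≤ (min 𝔠.gamma0 1) ^ 2) (K : ℕ), AlphaInputsT3AC.AdaptedClassNonemptyT3R F 𝔠 γ hγ hγ1 K)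
    (hrows : ∀ (γ : ℝ) (hγ : 0 < γ) (hγ1 : γ ≤ (min 𝔠.gamma0 1) ^ 2) (K : ℕ)
      (Ut : (k : ℕ) → GaugeField (F.P K) k (Matrix.specialUnitaryGroup (Fin 2) ℂ) → GaugeField (F.P K) 0 (Matrix.specialUnitaryGroup (Fin 2) ℂ)),
      AlphaInputsT3AC.TrivMinimiserRowsT3 F 𝔠 γ hγ hγ1 a₀ a₁ K Ut → AlphaInputsT3AC.DataRowsT3RChi F 𝔠 γ hγ hγ1 K Ut) :
    DataSchemaT3ACRChi F 𝔠 a₀ a₁ := by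
  intro γ hγ hγ1 K
  have hγ1' : γ ≤ 1 := hγ1.trans (sq_min_one_le _ 𝔠.gamma0_pos)
  have hγe : Real.sqrt γ ≤ Real.exp (1 - 𝔠.p₀) := (sqrt_le_exp_iff hγ.le).mpr (hγ1.trans hanti)
  have hL1 : 1 ≤ F.L := by have := F.hL.2; omega
  have hw0 : 0 ≤ (F.L : ℝ) ^ 2 * avgWindowFactor F.L := by
    have := avgWindowFactor_pos F
    positivity
  have hC2 : 2 * (F.L : ℝ) ^ 2 * avgWindowFactor F.L ≤ 𝔠.C68 := by nlinarith
  refine ⟨MinimiserPin.windowIneqT3_of_le F 𝔠 hγ hγ1' hγe hC2 K, hD6R γ hγ hγ1 K, ?_⟩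
  obtain ⟨Ut, hUt⟩ := AlphaInputsT3AC.trivMinimiserRowsT3_of_thm1GlobalMinAt F 𝔠 γ hγ hγ1 K hT hwin hA3 hA2 hB₃
    (fun k _ => hsmall γ hγ hγ1 K k)
    (fun k i hik hkK => MinimiserPin.C68_dom_of_le hL1 hγ hγ1' hγe 𝔠.b₀_pos 𝔠.p₀_pos.le (avgWindowFactor_pos F).le 𝔠.B₃_pos.le hC K k i hik hkK)
  exact ⟨Ut, hUt, hrows γ hγ hγ1 K Ut hUt⟩

/-- ★★ **THE READ-LOCAL χ-SCHEMA FROM [7] THEOREM 1, (D6R-CHARGED), THE PRINT-STRENGTH χ DATA ROW (O″χ), AND SIZES IN CLOSED FORM (incl. `7L + 3 ≤ M₁`)** — alpha-2's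
`dataSchemaT3ACR_of_pinnedRows₂C` verbatim in χ-currency: the two `γ`-rows from the two `C68`-inequalities (`MinimiserPin.anti_of_C68` ∕ `small_of_C68`), (D6R) from its charged
half under the collar `7L + 3 ≤ M₁` and `4π ≤ C68` (`adaptedClassNonemptyT3R_of_charged_of_collar`, `collarE_T3_of_M₁_ge`, `four_pi_le_C68_of_sizes`), the data row weakened to
(O″χ) «`(∃ Ut, Triv… Ut) → ∃ Ut, Triv… Ut ∧ DataRowsT3RChi … Ut`». [cite: Balaban1985Variational, Thm 1 (6)–(8) pp.278–279; Balaban1985UV3, (40)–(42) p.266, (47) p.267, (68) p.273 and Thm 2 p.272] -/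
theorem AlphaInputsT3AC.dataSchemaT3ACRChi_of_pinnedRows₂C {a₀ a₁ : ℝ}
    (hT : Thm1GlobalMinAt F.L a₀ a₁ 𝔠.B₃) (ha₁ : 0 < a₁) (hwin : 𝔠.B₃ * a₁ ≤ a₀)
    (hA3 : (143 * ((((3 + 4 : ℕ) : ℝ)) ^ 2 / 4) ^ 2) * (2 * (𝔠.B₃ * a₁)) ≤ 1 / 3)
    (hA2 : 2 * (2 * (𝔠.B₃ * a₁)) ≤ 2 * deltaSU (Fin 2) / (((3 + 4) * F.L : ℕ) : ℝ) ^ 2)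
    (hB₃ : 1 ≤ 2 * 𝔠.B₃) (hC : 4 * 𝔠.B₃ * (F.L : ℝ) ^ 2 * avgWindowFactor F.L ≤ 𝔠.C68)
    (hCe : Real.exp (𝔠.p₀ - 1) ≤ 3 * C0 3 * 𝔠.C68 * (𝔠.b₀ * Q0 𝔠.p₀))
    (hCa : (𝔠.b₀ * Q0 𝔠.p₀) * (2 * (F.L : ℝ) ^ 2 * avgWindowFactor F.L) ^ 2 ≤ 3 * C0 3 * 𝔠.C68 * a₁ ^ 2)
    (hM₁ : 7 * F.L + 3 ≤ 𝔠.M₁)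
    (hD6RC : ∀ (γ : ℝ) (hγ : 0 < γ) (hγ1 : γ ≤ (min 𝔠.gamma0 1) ^ 2) (K : ℕ), AlphaInputsT3AC.AdaptedClassNonemptyChargedT3R F 𝔠 γ hγ hγ1 K)
    (hrows : ∀ (γ : ℝ) (hγ : 0 < γ) (hγ1 : γ ≤ (min 𝔠.gamma0 1) ^ 2) (K : ℕ),
      (∃ Ut : (k : ℕ) → GaugeField (F.P K) k (Matrix.specialUnitaryGroup (Fin 2) ℂ) → GaugeField (F.P K) 0 (Matrix.specialUnitaryGroup (Fin 2) ℂ),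
        AlphaInputsT3AC.TrivMinimiserRowsT3 F 𝔠 γ hγ hγ1 a₀ a₁ K Ut) →
      ∃ Ut : (k : ℕ) → GaugeField (F.P K) k (Matrix.specialUnitaryGroup (Fin 2) ℂ) → GaugeField (F.P K) 0 (Matrix.specialUnitaryGroup (Fin 2) ℂ),
        AlphaInputsT3AC.TrivMinimiserRowsT3 F 𝔠 γ hγ hγ1 a₀ a₁ K Ut ∧ AlphaInputsT3AC.DataRowsT3RChi F 𝔠 γ hγ hγ1 K Ut) :
    DataSchemaT3ACRChi F 𝔠 a₀ a₁ := by
  have hL1 : 1 ≤ F.L := by have := F.hL.2; omega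
  have hanti := MinimiserPin.anti_of_C68 𝔠 hCe
  have hsmall := MinimiserPin.small_of_C68 𝔠 hL1 ha₁ (avgWindowFactor_pos F) hCa
  have hπ : 4 * Real.pi ≤ 𝔠.C68 := AlphaInputsT3AC.four_pi_le_C68_of_sizes (𝔠 := 𝔠) hB₃ hC
  intro γ hγ hγ1 K
  have hγ1' : γ ≤ 1 := hγ1.trans (sq_min_one_le _ 𝔠.gamma0_pos)
  have hγe : Real.sqrt γ ≤ Real.exp (1 - 𝔠.p₀) := (sqrt_le_exp_iff hγ.le).mpr (hγ1.trans hanti)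
  have hw0 : 0 ≤ (F.L : ℝ) ^ 2 * avgWindowFactor F.L := by
    have := avgWindowFactor_pos F
    positivity
  have hC2 : 2 * (F.L : ℝ) ^ 2 * avgWindowFactor F.L ≤ 𝔠.C68 := by nlinarith
  refine ⟨MinimiserPin.windowIneqT3_of_le F 𝔠 hγ hγ1' hγe hC2 K,
    AlphaInputsT3AC.adaptedClassNonemptyT3R_of_charged_of_collar (AlphaInputsT3AC.collarE_T3_of_M₁_ge (hγ := hγ) (hγ1 := hγ1) (K := K) hM₁) hπ (hD6RC γ hγ hγ1 K),
    hrows γ hγ hγ1 K ?_⟩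
  exact AlphaInputsT3AC.trivMinimiserRowsT3_of_thm1GlobalMinAt F 𝔠 γ hγ hγ1 K hT hwin hA3 hA2 hB₃
    (fun k _ => hsmall γ hγ hγ1 K k)
    (fun k i hik hkK => MinimiserPin.C68_dom_of_le hL1 hγ hγ1' hγe 𝔠.b₀_pos 𝔠.p₀_pos.le (avgWindowFactor_pos F).le
      𝔠.B₃_pos.le hC K k i hik hkK)

end Knit

/-! ## §2 The record-parametric display of 2′χ over the read-local class, and its constants shell -/

section Record

/-- ★ **`AlphaInputsT3AC.PinnedPartsT3ACRecRChi L` — 2′χ's DISPLAY AS ONE PREDICATE** (hypothesis schema, OPEN, never asserted; NAME MAP `PinnedPartsT3ACRecR ↦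
PinnedPartsT3ACRecRChi`): alpha-2's `AlphaInputsT3AC.PinnedPartsT3ACRecR L` VERBATIM with the data row in χ-currency (`DataRowsT3R ↦ DataRowsT3RChi`) — the quantifier shell
of the successor stub 2′χ's text `AlphaInputsT3ACv3RecChi L` (thresholds `b₁, p₁`; for every profile `(b₀, p₀)` beyond them a primitive-constants record `𝔠` with EXACTLY that
p-function and [Balaban1985Variational] constants `a₀, a₁`, `0 < a₀`, `0 < a₁`, `B₃a₁ ≤ a₀`) whose body is: [7]'s small-`a₁` regime (`143·(7²/4)²·2B₃a₁ ≤ ⅓`,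
`4B₃a₁ ≤ 2δ_SU(2)/(7L)²`); the record's sizes `1 ≤ 2B₃`, the three `C68`-rows LINEAR in the free (68)-constant and `7L + 3 ≤ M₁` (all free: `pinnedPartsT3ACRecR_shell`);
(T) `Thm1GlobalMinAt L a₀ a₁ 𝔠.B₃`; and for every three-torus family of block size `L`: (D6R-CHARGED) `AdaptedClassNonemptyChargedT3R` and (O″χ) GIVEN a measurable pinned
trivial-history minimiser family with (D5), the χ data rows `DataRowsT3RChi` hold for SOME such family.
[cite: Balaban1985UV3, (7) p.257, (40)–(42) p.266, (47) p.267, (68) p.273 and Thm 2 p.272; Balaban1985Variational, Thm 1 (6)–(8) pp.278–279; Balaban1985Averaging, Prop. 2 (54) p.26] -/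
def AlphaInputsT3AC.PinnedPartsT3ACRecRChi (L : ℕ) : Prop :=
  ∃ (b₁ p₁ : ℝ), ∀ (b₀ p₀ : ℝ), b₁ ≤ b₀ → p₁ ≤ p₀ →
    ∃ (𝔠 : AlphaConsts L (suGroupModel 2).N) (a₀ a₁ : ℝ), 𝔠.b₀ = b₀ ∧ 𝔠.p₀ = p₀ ∧ 0 < a₀ ∧ 0 < a₁ ∧ 𝔠.B₃ * a₁ ≤ a₀ ∧
      (143 * ((((3 + 4 : ℕ) : ℝ)) ^ 2 / 4) ^ 2) * (2 * (𝔠.B₃ * a₁)) ≤ 1 / 3 ∧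
      2 * (2 * (𝔠.B₃ * a₁)) ≤ 2 * deltaSU (Fin 2) / (((3 + 4) * L : ℕ) : ℝ) ^ 2 ∧
      1 ≤ 2 * 𝔠.B₃ ∧ 4 * 𝔠.B₃ * (L : ℝ) ^ 2 * avgWindowFactor L ≤ 𝔠.C68 ∧
      Real.exp (𝔠.p₀ - 1) ≤ 3 * C0 3 * 𝔠.C68 * (𝔠.b₀ * Q0 𝔠.p₀) ∧
      (𝔠.b₀ * Q0 𝔠.p₀) * (2 * (L : ℝ) ^ 2 * avgWindowFactor L) ^ 2 ≤ 3 * C0 3 * 𝔠.C68 * a₁ ^ 2 ∧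
      7 * L + 3 ≤ 𝔠.M₁ ∧
      Thm1GlobalMinAt L a₀ a₁ 𝔠.B₃ ∧
      ∀ (F : T3Family) (hF : F.L = L),
        (∀ (γ : ℝ) (hγ : 0 < γ) (hγ1 : γ ≤ (min (hF ▸ 𝔠).gamma0 1) ^ 2) (K : ℕ),
          AlphaInputsT3AC.AdaptedClassNonemptyChargedT3R F (hF ▸ 𝔠) γ hγ hγ1 K) ∧
        (∀ (γ : ℝ) (hγ : 0 < γ) (hγ1 : γ ≤ (min (hF ▸ 𝔠).gamma0 1) ^ 2) (K : ℕ),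
          (∃ Ut : (k : ℕ) → GaugeField (F.P K) k (Matrix.specialUnitaryGroup (Fin 2) ℂ) → GaugeField (F.P K) 0 (Matrix.specialUnitaryGroup (Fin 2) ℂ),
            AlphaInputsT3AC.TrivMinimiserRowsT3 F (hF ▸ 𝔠) γ hγ hγ1 a₀ a₁ K Ut) →
          ∃ Ut : (k : ℕ) → GaugeField (F.P K) k (Matrix.specialUnitaryGroup (Fin 2) ℂ) → GaugeField (F.P K) 0 (Matrix.specialUnitaryGroup (Fin 2) ℂ),
            AlphaInputsT3AC.TrivMinimiserRowsT3 F (hF ▸ 𝔠) γ hγ hγ1 a₀ a₁ K Ut ∧ AlphaInputsT3AC.DataRowsT3RChi F (hF ▸ 𝔠) γ hγ hγ1 K Ut)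

/-- At a family of block size `L` the body of `PinnedPartsT3ACRecRChi` gives the read-local χ-schema (§1 after transport along `hF`).
[cite: Balaban1985UV3, Thm 2 p.272; Balaban1985Variational, Thm 1 (8) p.279] -/
theorem AlphaInputsT3AC.dataSchemaT3ACRChi_of_pinnedPartsRChi_cast {L : ℕ} {𝔠 : AlphaConsts L (suGroupModel 2).N} {a₀ a₁ : ℝ}
    (ha₁ : 0 < a₁) (hwin : 𝔠.B₃ * a₁ ≤ a₀)
    (hA3 : (143 * ((((3 + 4 : ℕ) : ℝ)) ^ 2 / 4) ^ 2) * (2 * (𝔠.B₃ * a₁)) ≤ 1 / 3)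
    (hA2 : 2 * (2 * (𝔠.B₃ * a₁)) ≤ 2 * deltaSU (Fin 2) / (((3 + 4) * L : ℕ) : ℝ) ^ 2)
    (hB₃ : 1 ≤ 2 * 𝔠.B₃) (hC : 4 * 𝔠.B₃ * (L : ℝ) ^ 2 * avgWindowFactor L ≤ 𝔠.C68)
    (hCe : Real.exp (𝔠.p₀ - 1) ≤ 3 * C0 3 * 𝔠.C68 * (𝔠.b₀ * Q0 𝔠.p₀))
    (hCa : (𝔠.b₀ * Q0 𝔠.p₀) * (2 * (L : ℝ) ^ 2 * avgWindowFactor L) ^ 2 ≤ 3 * C0 3 * 𝔠.C68 * a₁ ^ 2)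
    (hM₁ : 7 * L + 3 ≤ 𝔠.M₁)
    (hT : Thm1GlobalMinAt L a₀ a₁ 𝔠.B₃) (F : T3Family) (hF : F.L = L)
    (hD6RC : ∀ (γ : ℝ) (hγ : 0 < γ) (hγ1 : γ ≤ (min (hF ▸ 𝔠).gamma0 1) ^ 2) (K : ℕ),
      AlphaInputsT3AC.AdaptedClassNonemptyChargedT3R F (hF ▸ 𝔠) γ hγ hγ1 K)
    (hrows : ∀ (γ : ℝ) (hγ : 0 < γ) (hγ1 : γ ≤ (min (hF ▸ 𝔠).gamma0 1) ^ 2) (K : ℕ),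
      (∃ Ut : (k : ℕ) → GaugeField (F.P K) k (Matrix.specialUnitaryGroup (Fin 2) ℂ) → GaugeField (F.P K) 0 (Matrix.specialUnitaryGroup (Fin 2) ℂ),
        AlphaInputsT3AC.TrivMinimiserRowsT3 F (hF ▸ 𝔠) γ hγ hγ1 a₀ a₁ K Ut) →
      ∃ Ut : (k : ℕ) → GaugeField (F.P K) k (Matrix.specialUnitaryGroup (Fin 2) ℂ) → GaugeField (F.P K) 0 (Matrix.specialUnitaryGroup (Fin 2) ℂ),
        AlphaInputsT3AC.TrivMinimiserRowsT3 F (hF ▸ 𝔠) γ hγ hγ1 a₀ a₁ K Ut ∧ AlphaInputsT3AC.DataRowsT3RChi F (hF ▸ 𝔠) γ hγ hγ1 K Ut) :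
    DataSchemaT3ACRChi F (hF ▸ 𝔠) a₀ a₁ := by
  subst hF
  exact AlphaInputsT3AC.dataSchemaT3ACRChi_of_pinnedRows₂C F 𝔠 hT ha₁ hwin hA3 hA2 hB₃ hC hCe hCa hM₁ hD6RC hrows

/-- ★ **THE CONSTANTS SHELL OF THE READ-LOCAL DISPLAYS `PinnedPartsT3ACRecR L` ∕ `PinnedPartsT3ACRecRChi L` HOLDS** for every block size `L > 1` (they share it): thresholds
`b₁, p₁ := 3` such that for every profile beyond them there is a record with EXACTLY that p-function and [7] constants `a₀ = a₁ > 0` with `B₃a₁ ≤ a₀`, the small-`a₁` rows,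
`1 ≤ 2B₃` (`B₃ := 1`), the three `C68`-rows and `7L + 3 ≤ M₁` — i.e. the display with its three mass rows (T) `Thm1GlobalMinAt`, (D6R-CHARGED), (O″)∕(O″χ) deleted (lane A's
`pinnedPartsT3ACRec_shell` run on alpha-2's `exists_record_sizes_M₁`).  CERTIFICATE that the display's constants bookkeeping is consistent and free; all content of 2′∕2′χ's
read-local display is (T) + (D6R-CHARGED) + the data row.
[cite: Balaban1985UV3, (7) p.257, (40) p.266 and (68) p.273 (bookkeeping); Balaban1985Variational, Thm 1 (6)–(8) pp.278–279 (constants regime)] -/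
theorem AlphaInputsT3AC.pinnedPartsT3ACRecR_shell {L : ℕ} (hL : 1 < L) (N : ℕ) :
    ∃ (b₁ p₁ : ℝ), ∀ (b₀ p₀ : ℝ), b₁ ≤ b₀ → p₁ ≤ p₀ →
      ∃ (𝔠 : AlphaConsts L N) (a₀ a₁ : ℝ), 𝔠.b₀ = b₀ ∧ 𝔠.p₀ = p₀ ∧ 0 < a₀ ∧ 0 < a₁ ∧ 𝔠.B₃ * a₁ ≤ a₀ ∧
        (143 * ((((3 + 4 : ℕ) : ℝ)) ^ 2 / 4) ^ 2) * (2 * (𝔠.B₃ * a₁)) ≤ 1 / 3 ∧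
        2 * (2 * (𝔠.B₃ * a₁)) ≤ 2 * deltaSU (Fin 2) / (((3 + 4) * L : ℕ) : ℝ) ^ 2 ∧
        1 ≤ 2 * 𝔠.B₃ ∧ 4 * 𝔠.B₃ * (L : ℝ) ^ 2 * avgWindowFactor L ≤ 𝔠.C68 ∧
        Real.exp (𝔠.p₀ - 1) ≤ 3 * C0 3 * 𝔠.C68 * (𝔠.b₀ * Q0 𝔠.p₀) ∧
        (𝔠.b₀ * Q0 𝔠.p₀) * (2 * (L : ℝ) ^ 2 * avgWindowFactor L) ^ 2 ≤ 3 * C0 3 * 𝔠.C68 * a₁ ^ 2 ∧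
        7 * L + 3 ≤ 𝔠.M₁ := by
  -- the [7] constant `a₁(L)` and `B₃ := 1`
  set a₁ : ℝ := min (1 / (6 * (143 * ((((3 + 4 : ℕ) : ℝ)) ^ 2 / 4) ^ 2))) (deltaSU (Fin 2) / (2 * (((3 + 4) * L : ℕ) : ℝ) ^ 2))
    with ha₁_def
  have ha₁ : 0 < a₁ := AlphaInputsT3AC.a₁Witness_pos L hL
  have hK : (0 : ℝ) < 143 * ((((3 + 4 : ℕ) : ℝ)) ^ 2 / 4) ^ 2 := by positivity
  have h7L : (0 : ℝ) < (((3 + 4) * L : ℕ) : ℝ) ^ 2 := by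
    have : 0 < (3 + 4) * L := by omega
    have h : (0 : ℝ) < (((3 + 4) * L : ℕ) : ℝ) := by exact_mod_cast this
    positivity
  -- a seed record with `B₃ = 1`, then alpha-2's sizes-with-`M₁` at the target profile
  obtain ⟨𝔠₀, h𝔠₀⟩ := AlphaInputsT3AC.exists_alphaConsts hL N one_pos
  obtain ⟨b₁, -, h⟩ := AlphaInputsT3AC.exists_record_sizes_M₁ 𝔠₀ ha₁
  refine ⟨b₁, 3, fun b₀ p₀ hb hp => ?_⟩
  obtain ⟨𝔠, h1, h2, hB', s1, s2, s3, s4⟩ := h b₀ p₀ hb hp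
  have hB : 𝔠.B₃ = 1 := hB'.trans h𝔠₀
  refine ⟨𝔠, a₁, a₁, h1, h2, ha₁, ha₁, by rw [hB, one_mul], ?_, ?_, by rw [hB]; norm_num, s1, s2, s3, s4⟩
  · -- `143·(7²/4)²·(2·a₁) ≤ ⅓` from `a₁ ≤ 1/(6·143·(7²/4)²)`
    rw [hB, one_mul]
    have hle : a₁ ≤ 1 / (6 * (143 * ((((3 + 4 : ℕ) : ℝ)) ^ 2 / 4) ^ 2)) := min_le_left _ _
    calc 143 * ((((3 + 4 : ℕ) : ℝ)) ^ 2 / 4) ^ 2 * (2 * a₁)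
        ≤ 143 * ((((3 + 4 : ℕ) : ℝ)) ^ 2 / 4) ^ 2 * (2 * (1 / (6 * (143 * ((((3 + 4 : ℕ) : ℝ)) ^ 2 / 4) ^ 2)))) := by gcongr
      _ = 1 / 3 := by field_simp; ring
  · -- `2·(2·a₁) ≤ 2δ/(7L)²` from `a₁ ≤ δ/(2(7L)²)`
    rw [hB, one_mul]
    have hle : a₁ ≤ deltaSU (Fin 2) / (2 * (((3 + 4) * L : ℕ) : ℝ) ^ 2) := min_le_right _ _
    calc 2 * (2 * a₁) ≤ 2 * (2 * (deltaSU (Fin 2) / (2 * (((3 + 4) * L : ℕ) : ℝ) ^ 2))) := by gcongr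
      _ = 2 * deltaSU (Fin 2) / (((3 + 4) * L : ℕ) : ℝ) ^ 2 := by field_simp

end Record

end Summit.QuantumFields.YangMills.Theorems

end
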